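import Literature.Geometry.Lorentzian.KerrFarLeafEnergy
import Literature.Geometry.Lorentzian.MinkowskiRadialMultiplier
import HarnessLib

/-!
# The smeared plate Hardy identity: the spatial Euler current `f ψ̃² y⃗/|y⃗|²` between a lower
# graph and a leaf `Σ̃_t(h♯_{R₁})`, cut off in time by `χ'(T* − t*)`

(family `gr`; infrastructure for statement **gr.S24**, the (HardyPlate) step of Moschidis,
arXiv:1509.08489, proof of Lemma 4.5, in the smeared-truncation framework of
`KerrSchildTruncatedCurrent.lean`; namespace `Literature.Geometry.Lorentzian.Kerr`)

The zeroth-order terms of the Morawetz and `r^p` currents on the time plates `{t* = t'}` (which in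
the smeared framework appear integrated against `χ'(T* − t')`) are controlled by a Hardy
inequality *on the plates*, whose edge terms live on the two graph hypersurfaces bounding the
wedge. In the smeared framework this is the identity of `KerrSchildTruncatedCurrent.lean`
(`E4.graphFlux_sub_eq_integral_integral_timeCutoff`) for the purely spatial current
`J = (0, Q y⃗/|y⃗|²)`, `Q = f ψ̃²` (`f(x) = u_{R',R'}(x⃗)` the radial cut-off), with the profile
`χ'` (`χ = Real.smoothTransition`; `χ' ∈ C^∞` vanishes on `(−∞, 0]`):

* `Kerr.plateCurrent`, an `abbrev` for `J`; `Kerr.contDiff_plateCurrent` (globally `C¹`);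
* `Kerr.sum_fderiv_plateCurrent` (**proved**): on the far region,
  `∑_μ ∂_μ J^μ = ((y⃗·∇f) ψ̃² + 2 f ψ̃ (y⃗·∇_y ψ̃) + f ψ̃²)/|y⃗|²` (`div(y⃗/|y⃗|²) = 1/|y⃗|²` in
  dimension three);
* `Kerr.plateHardy_identity` (**proved**): for an admissible `ψ`, `0 ≤ s ≤ t`, a lower `C²` height
  `0 ≤ F₁ ≤ h♯_{R₁}`,
  `∫ χ'(T − t − h♯) (J·n^{h♯})|_{Σ̃_t} dy − ∫ χ'(T − s − F₁) (J·n^{F₁})|_{(s + F₁(y), y)} dy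
     = ∫_y ∫_{t' ∈ (s + F₁(y), t + h♯(y)]} χ'(T − t') ∑_μ ∂_μ J^μ (t', y) dt' dy`,
  where `J·n^F = −Q (y⃗·∇F)/|y⃗|²` (the smeared *edge terms* on the two graphs; nonpositive on a
  radially increasing height, zero on a slice).

The inequality form (AM–GM in the bulk, `(y⃗·∇_yψ̃)²/|y⃗|² ≤ 4 T(V,V)`, the plate energy of
`Kerr.farLeafFlux_and_plateEnergy_le`) is assembled by the users. No named facts (D-0026).

## References

* G. Moschidis, arXiv:1509.08489, proof of Lemma 4.5, (HardyPlate) (key `Moschidis2016`).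
* M. Dafermos, I. Rodnianski, Y. Shlapentokh-Rothman, arXiv:1402.7034, §4.3
  (key `DafermosRodnianskiShlapentokhrothman2014`).
-/

noncomputable section

open Bundle Set TopologicalSpace Filter MeasureTheory Metric
open scoped Manifold ContDiff Topology ENNReal

namespace Literature.Geometry.Lorentzian

namespace Kerr

/-! ### The spatial Euler current `J = (0, Q y⃗/|y⃗|²)` -/

/-- The **plate current** of a scalar `Q` on `ℝ⁴`: the purely spatial Euler field
`J^0 = 0`, `J^i = Q(x) xⁱ/|x⃗|²` (`i = 1,2,3`), whose divergence is `(x⃗·∇Q + Q)/|x⃗|²` and whose flux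
through a graph `{x⁰ = τ + F(x⃗)}` is `−Q (x⃗·∇F)/|x⃗|²` — the vehicle of the Hardy inequality on the
time plates in the smeared-truncation framework. [folklore] -/
def plateCurrent (Q : E4 → ℝ) (μ : Fin 4) (x : E4) : ℝ :=
  if μ = 0 then 0 else Q x * x μ / E4.spatialNorm x ^ 2

/-- `J^0 = 0`. [folklore] -/
theorem plateCurrent_zero (Q : E4 → ℝ) (x : E4) : plateCurrent Q 0 x = 0 := by
  simp [plateCurrent]

/-- `J^i = Q xⁱ/|x⃗|²`. [folklore] -/
theorem plateCurrent_succ (Q : E4 → ℝ) (i : Fin 3) (x : E4) :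
    plateCurrent Q i.succ x = Q x * x i.succ / E4.spatialNorm x ^ 2 := by
  simp [plateCurrent, Fin.succ_ne_zero]

/-- The plate current of a `C¹` scalar supported away from the time axis is `C¹`. [folklore] -/
theorem contDiff_plateCurrent {Q : E4 → ℝ} {R : ℝ} (hR : 0 < R)
    (hQU : tsupport Q ⊆ {x : E4 | R ≤ E4.spatialNorm x}) (hQ : ContDiff ℝ 1 Q) (μ : Fin 4) :
    ContDiff ℝ 1 (plateCurrent Q μ) := by
  refine Fin.cases ?_ (fun i ↦ ?_) μ
  · have : plateCurrent Q 0 = fun _ ↦ 0 := funext (plateCurrent_zero Q)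
    rw [this]; exact contDiff_const
  · have heq : plateCurrent Q i.succ = fun x ↦ Q x * (x i.succ / E4.spatialNorm x ^ 2) := by
      funext x; rw [plateCurrent_succ]; ring
    rw [heq]
    refine E4.contDiff_mul_of_tsupport_subset hQU hQ fun x hx ↦ ?_
    have hx0 : E4.spatialNorm x ^ 2 ≠ 0 := pow_ne_zero 2 (hR.trans_le hx).ne'
    exact ((E4.dx i.succ).contDiff.contDiffAt).div ((contDiff_norm_sq ℝ).comp E4.spatial.contDiff).contDiffAt hx0

/-! ### The divergence of the plate current -/

/-- **`div (Q x⃗/|x⃗|²) = (DQ(x)[(0, x⃗)] + Q(x))/|x⃗|²`** at points off the time axis where `Q` is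
differentiable (`div(x⃗/|x⃗|²) = 1/|x⃗|²` in three space dimensions). [folklore] -/
theorem sum_fderiv_plateCurrent {Q : E4 → ℝ} {x : E4} (hx : 0 < E4.spatialNorm x)
    (hQ : DifferentiableAt ℝ Q x) :
    ∑ μ, fderiv ℝ (plateCurrent Q μ) x (E4.basisVector μ) =
      (fderiv ℝ Q x (E4.ofTimeSpace 0 (E4.spatial x)) + Q x) / E4.spatialNorm x ^ 2 := by
  set σ : ℝ := E4.spatialNorm x ^ 2 with hσ
  have hρ : σ ≠ 0 := pow_ne_zero 2 hx.ne'
  have hS := KerrSchild.hasFDerivAt_spatialNormSq x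
  set S' : E4 →L[ℝ] ℝ := (2 * x 1) • E4.dx 1 + (2 * x 2) • E4.dx 2 + (2 * x 3) • E4.dx 3 with hS'
  have hSi : ∀ i : Fin 3, S' (E4.basisVector i.succ) = 2 * x i.succ := by
    intro i
    have h := KerrSchild.fderiv_spatialNormSq_apply x i.succ
    rw [hS.fderiv, if_neg (Fin.succ_ne_zero i)] at h
    exact h
  -- `gᵢ = xⁱ σ⁻¹`
  have hinv : HasFDerivAt (fun z : E4 ↦ (E4.spatialNorm z ^ 2)⁻¹) ((-(σ ^ 2)⁻¹) • S') x :=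
    (hasDerivAt_inv hρ).comp_hasFDerivAt x hS
  have hg : ∀ i : Fin 3, HasFDerivAt (fun z : E4 ↦ z i.succ * (E4.spatialNorm z ^ 2)⁻¹)
      (x i.succ • ((-(σ ^ 2)⁻¹) • S') + σ⁻¹ • E4.dx i.succ) x := fun i ↦
    (KerrSchild.hasFDerivAt_coord i.succ x).mul hinv
  have hJ : ∀ i : Fin 3, HasFDerivAt (plateCurrent Q i.succ)
      (Q x • (x i.succ • ((-(σ ^ 2)⁻¹) • S') + σ⁻¹ • E4.dx i.succ) +
        (x i.succ * σ⁻¹) • fderiv ℝ Q x) x := by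
    intro i
    have heq : plateCurrent Q i.succ = fun z ↦ Q z * (z i.succ * (E4.spatialNorm z ^ 2)⁻¹) := by
      funext z; rw [plateCurrent_succ, div_eq_mul_inv, mul_assoc]
    rw [heq]
    exact hQ.hasFDerivAt.mul (hg i)
  have hJi : ∀ i : Fin 3, fderiv ℝ (plateCurrent Q i.succ) x (E4.basisVector i.succ) =
      Q x * (x i.succ * (-(σ ^ 2)⁻¹ * (2 * x i.succ)) + σ⁻¹) +
        x i.succ * σ⁻¹ * fderiv ℝ Q x (E4.basisVector i.succ) := by
    intro i
    rw [(hJ i).fderiv]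
    simp only [_root_.add_apply, _root_.smul_apply, smul_eq_mul, hSi i, Kerr.dx_basisVector,
      if_true, mul_one]
  have hJ0 : fderiv ℝ (plateCurrent Q 0) x (E4.basisVector 0) = 0 := by
    have : plateCurrent Q 0 = fun _ ↦ 0 := funext (plateCurrent_zero Q)
    rw [this]; simp
  -- `DQ(x)[(0, x⃗)] = ∑ᵢ xⁱ ∂ᵢQ` and `∑ᵢ (xⁱ)² = σ`
  have hDQ : fderiv ℝ Q x (E4.ofTimeSpace 0 (E4.spatial x)) =
      ∑ i : Fin 3, x i.succ * fderiv ℝ Q x (E4.basisVector i.succ) := by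
    have hv : E4.ofTimeSpace 0 (E4.spatial x) = ∑ i : Fin 3, x i.succ • E4.basisVector i.succ := by
      ext μ
      refine Fin.cases ?_ (fun j ↦ ?_) μ
      · simp [E4.ofTimeSpace_apply_zero, Fin.sum_univ_three, E4.basisVector]
      · rw [E4.ofTimeSpace_apply_succ, E4.spatial_apply]
        simp [Fin.sum_univ_three, E4.basisVector]
        fin_cases j <;> simp
    rw [hv, map_sum]
    exact Finset.sum_congr rfl fun i _ ↦ by rw [map_smul, smul_eq_mul]
  have hsq : ∑ i : Fin 3, x i.succ ^ 2 = σ := by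
    rw [hσ, E4.spatialNorm_sq, Fin.sum_univ_three]
    rfl
  rw [Fin.sum_univ_succ, hJ0, zero_add]
  simp_rw [hJi]
  rw [Finset.sum_add_distrib, hDQ]
  have h1 : ∑ i : Fin 3, Q x * (x i.succ * (-(σ ^ 2)⁻¹ * (2 * x i.succ)) + σ⁻¹) =
      Q x * (-(σ ^ 2)⁻¹ * 2 * (∑ i : Fin 3, x i.succ ^ 2) + 3 * σ⁻¹) := by
    rw [← Finset.mul_sum]
    congr 1
    simp only [Finset.sum_add_distrib, Finset.sum_const, Finset.card_univ, Fintype.card_fin,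
      nsmul_eq_mul, Nat.cast_ofNat, Finset.mul_sum]
    congr 1
    exact Finset.sum_congr rfl fun i _ ↦ by ring
  have h2 : ∑ i : Fin 3, x i.succ * σ⁻¹ * fderiv ℝ Q x (E4.basisVector i.succ) =
      σ⁻¹ * ∑ i : Fin 3, x i.succ * fderiv ℝ Q x (E4.basisVector i.succ) := by
    rw [Finset.mul_sum]
    exact Finset.sum_congr rfl fun i _ ↦ by ring
  rw [h1, h2, hsq]
  field_simp
  ring

/-! ### The flux of the plate current through a graph and the identity -/

/-- The flux density of the plate current through the graph of `F`:
`∑_μ J^μ n^F_μ = −Q · DF(y)[y]/|y|²` at the point `(t', y)`. [folklore] -/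
theorem sum_plateCurrent_mul_graphConormal (Q : E4 → ℝ) (F : E3 → ℝ) (t' : ℝ) (y : E3) :
    ∑ μ, plateCurrent Q μ (E4.ofTimeSpace t' y) * graphConormal F y μ =
      -(Q (E4.ofTimeSpace t' y) * fderiv ℝ F y y / ‖y‖ ^ 2) := by
  rw [Fin.sum_univ_succ, plateCurrent_zero, zero_mul, zero_add]
  have hexp : y = ∑ i : Fin 3, y i • EuclideanSpace.single i (1 : ℝ) := by
    ext j; simp [Fin.sum_univ_three]; fin_cases j <;> simp
  have hy : fderiv ℝ F y y = ∑ i : Fin 3, y i * fderiv ℝ F y (EuclideanSpace.single i 1) := by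
    rw [show fderiv ℝ F y y = fderiv ℝ F y (∑ i : Fin 3, y i • EuclideanSpace.single i (1 : ℝ)) from
      congrArg (fderiv ℝ F y) hexp, map_sum]
    exact Finset.sum_congr rfl fun i _ ↦ by rw [map_smul, smul_eq_mul]
  have hn : E4.spatialNorm (E4.ofTimeSpace t' y) = ‖y‖ := E4.spatialNorm_ofTimeSpace t' y
  simp only [plateCurrent_succ, E4.ofTimeSpace_apply_succ, graphConormal_succ, partialE3, hn]
  rw [hy, Finset.mul_sum]
  have hterm : ∀ i : Fin 3, Q (E4.ofTimeSpace t' y) * y i / ‖y‖ ^ 2 *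
      -fderiv ℝ F y (EuclideanSpace.single i 1) =
      (-(Q (E4.ofTimeSpace t' y) * (y i * fderiv ℝ F y (EuclideanSpace.single i 1)))) / ‖y‖ ^ 2 :=
    fun i ↦ by ring
  simp only [hterm]
  rw [← Finset.sum_div, Finset.sum_neg_distrib, neg_div]

variable [Facts] [SliceFacts]

/-- **The smeared plate Hardy identity** (the spatial Euler current `J = (0, f ψ̃² y⃗/|y⃗|²)`
between the lower graph `{t* = s + F₁}` and the leaf `Σ̃_t(h♯_{R₁})`, profile `χ'(T − t*)`): for an
admissible `ψ`, `0 ≤ s ≤ t`, `R' > R_af`, a `C²` height `0 ≤ F₁ ≤ h♯_{R₁}`, with `Q = f ψ̃²`,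
`−∫ χ'(T − t − h♯(y)) Q (y·∇h♯)/|y|² |_{Σ̃_t} dy + ∫ χ'(T − s − F₁(y)) Q (y·∇F₁)/|y|² |_{(s+F₁(y),y)} dy
   = ∫_y ∫_{(s + F₁(y), t + h♯(y)]} χ'(T − t') (DQ[(0,y)] + Q)(t', y)/|y|² dt' dy`
(`E4.graphFlux_sub_eq_integral_integral_timeCutoff` with the profile `χ'`, which vanishes on
`(−∞, 0]`; `J⁰ = 0`). Moschidis arXiv:1509.08489, proof of Lemma 4.5, (HardyPlate), in smeared form.
[cite: Moschidis2016, Lemma 4.5 (proof)] -/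
theorem plateHardy_identity {M a R₁ R' : ℝ} (hMa : IsSubextremal M a) (hR₁ : 2 * M < R₁)
    (hR'af : afRadius a (rPlus M a) < R') {ψ : region a (rPlus M a) → ℝ}
    (hψ : IsAdmissibleKerrWave M a ψ) {ρ₀ : ℝ}
    (hρ₀ : ∀ x : E4, 0 ≤ x 0 → ρ₀ + x 0 < E4.spatialNorm x →
      Function.extend Subtype.val ψ 0 x = 0 ∧ fderiv ℝ (Function.extend Subtype.val ψ 0) x = 0)
    {F₁ : E3 → ℝ} (hF₁ : ContDiff ℝ 2 F₁) (hF₁0 : ∀ y, 0 ≤ F₁ y)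
    (hF₁h : ∀ y, F₁ y ≤ scriHeight M a R₁ y) {s t : ℝ} (hs : 0 ≤ s) (hst : s ≤ t) (T : ℝ) :
    (∫ y, deriv Real.smoothTransition (T - (t + scriHeight M a R₁ y)) *
        -((radialTransition R' R' y * Function.extend Subtype.val ψ 0
            (E4.ofTimeSpace (t + scriHeight M a R₁ y) y) ^ 2) *
          fderiv ℝ (scriHeight M a R₁) y y / ‖y‖ ^ 2)) -
      ∫ y, deriv Real.smoothTransition (T - (s + F₁ y)) *
        -((radialTransition R' R' y * Function.extend Subtype.val ψ 0
            (E4.ofTimeSpace (s + F₁ y) y) ^ 2) * fderiv ℝ F₁ y y / ‖y‖ ^ 2) =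
      ∫ y, ∫ t' in Set.Ioc (s + F₁ y) (t + scriHeight M a R₁ y),
        deriv Real.smoothTransition (T - t') *
          ((fderiv ℝ (fun x : E4 ↦ radialTransition R' R' (E4.spatial x) *
              Function.extend Subtype.val ψ 0 x ^ 2) (E4.ofTimeSpace t' y) (E4.ofTimeSpace 0 y) +
            radialTransition R' R' y * Function.extend Subtype.val ψ 0 (E4.ofTimeSpace t' y) ^ 2) /
            ‖y‖ ^ 2) := by
  have hM : 0 < M := hMa.pos
  have hR' : 0 < R' := (afRadius_pos a (rPlus M a)).trans hR'af
  have hRp : rPlus M a < R₁ := (rPlus_le_two_mul hM.le).trans_lt hR₁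
  set Φ : E4 → ℝ := Function.extend Subtype.val ψ 0 with hΦ
  set f : E4 → ℝ := fun x ↦ radialTransition R' R' (E4.spatial x) with hf
  set Q : E4 → ℝ := fun x ↦ f x * Φ x ^ 2 with hQ
  set U : Set E4 := {x | afRadius a (rPlus M a) < E4.spatialNorm x} with hU
  set h : E3 → ℝ := scriHeight M a R₁ with hh
  have hfU : tsupport f ⊆ U := fun x hx ↦
    hR'af.trans_le (tsupport_radialTransition_comp_spatial_subset hR' hx)
  have hfR : tsupport f ⊆ {x : E4 | R' ≤ E4.spatialNorm x} := fun x hx ↦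
    tsupport_radialTransition_comp_spatial_subset hR' hx
  have hf1 : ContDiff ℝ 1 f := contDiff_radialTransition_comp_spatial hR'
  have hmemU : ∀ x ∈ U, x ∈ region a (rPlus M a) := fun x hx ↦ mem_region_of_afRadius_lt_spatialNorm hx
  have hw : ∀ x ∈ U, ContDiffAt ℝ 1 (fun x ↦ Φ x ^ 2) x := fun x hx ↦
    ((hψ.contDiffAt_extend_of_mem (hmemU x hx)).of_le one_le_two).pow 2
  have hQ1 : ContDiff ℝ 1 Q := E4.contDiff_mul_of_tsupport_subset hfU hf1 hw
  have hQU : tsupport Q ⊆ {x : E4 | R' ≤ E4.spatialNorm x} :=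
    (tsupport_mul_subset_left (f := f) (g := fun x ↦ Φ x ^ 2)).trans hfR
  have hJ1 : ∀ μ, ContDiff ℝ 1 (plateCurrent Q μ) := contDiff_plateCurrent hR' hQU hQ1
  -- the profile `χ'`: `C¹`, vanishing on `(−∞, 0]` (cf. the lemmas of the same name in
  -- `Literature/NumberTheory/Automorphic/`, not imported here)
  have hζ : ContDiff ℝ 1 (deriv Real.smoothTransition) :=
    (contDiff_infty_iff_deriv.1 (Real.smoothTransition.contDiff (n := ⊤))).2.of_le
      (by exact_mod_cast le_top)
  have hζ0 : ∀ σ ≤ (0 : ℝ), deriv Real.smoothTransition σ = 0 := by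
    intro σ hσ
    rcases lt_or_eq_of_le hσ with hlt | rfl
    · have hev : Real.smoothTransition =ᶠ[𝓝 σ] fun _ ↦ 0 := by
        filter_upwards [(isOpen_gt' (0 : ℝ)).mem_nhds hlt] with ρ hρ
        exact Real.smoothTransition.zero_of_nonpos (le_of_lt hρ)
      rw [hev.deriv_eq]; simp
    · have hc : Continuous (deriv Real.smoothTransition) := hζ.continuous
      have hlim : Tendsto (deriv Real.smoothTransition) (𝓝[<] (0 : ℝ))
          (𝓝 (deriv Real.smoothTransition 0)) := hc.continuousAt.continuousWithinAt.tendsto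
      have hev : deriv Real.smoothTransition =ᶠ[𝓝[<] (0 : ℝ)] fun _ ↦ 0 := by
        filter_upwards [self_mem_nhdsWithin] with ρ hρ
        have hev' : Real.smoothTransition =ᶠ[𝓝 ρ] fun _ ↦ 0 := by
          filter_upwards [(isOpen_gt' (0 : ℝ)).mem_nhds hρ] with ρ' hρ'
          exact Real.smoothTransition.zero_of_nonpos (le_of_lt hρ')
        rw [hev'.deriv_eq]; simp
      exact tendsto_nhds_unique (hlim.congr' hev) tendsto_const_nhds
  have hF : ContDiff ℝ 2 h := hMa.contDiff_scriHeight hRp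
  have hF₂ : ContDiff ℝ 2 fun y ↦ (t - s) + h y := contDiff_const.add hF
  have hle : ∀ y, F₁ y ≤ (t - s) + h y := fun y ↦ by linarith [hF₁h y, sub_nonneg.2 hst]
  have hJ0 : ∀ μ (x : E4), ρ₀ + T < E4.spatialNorm x → s + F₁ (E4.spatial x) ≤ x 0 →
      x 0 ≤ s + ((t - s) + h (E4.spatial x)) → x 0 < T → plateCurrent Q μ x = 0 := by
    intro μ x hxρ hx1 _ hxT
    have hx0 : 0 ≤ x 0 := by linarith [hF₁0 (E4.spatial x)]
    have hΦ0 : Φ x = 0 := (hρ₀ x hx0 (by linarith)).1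
    have hQ0 : Q x = 0 := by simp [hQ, hΦ0]
    refine Fin.cases ?_ (fun i ↦ ?_) μ
    · exact plateCurrent_zero Q x
    · rw [plateCurrent_succ, hQ0]; simp
  have hid := E4.graphFlux_sub_eq_integral_integral_timeCutoff (J := plateCurrent Q) hJ1 hζ hζ0
    hF₁ hF₂ hle (τ := s) (T := T) (ρ := ρ₀ + T) hJ0
  have hn : ∀ (y : E3) (μ : Fin 4),
      graphConormal (fun y ↦ t - s + h y) y μ = graphConormal h y μ := by
    intro y μ
    refine Fin.cases rfl (fun i ↦ ?_) μ
    simp only [graphConormal_succ, partialE3, fderiv_const_add]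
  have hQval : ∀ t'' (y : E3), Q (E4.ofTimeSpace t'' y) =
      radialTransition R' R' y * Φ (E4.ofTimeSpace t'' y) ^ 2 := fun t'' y ↦ by
    simp [hQ, hf, E4.spatial_ofTimeSpace]
  simp only [show ∀ y, s + (t - s + h y) = t + h y from fun y ↦ by ring, hn,
    sum_plateCurrent_mul_graphConormal, plateCurrent_zero, mul_zero, sub_zero, hQval] at hid
  rw [hid]
  -- the divergence
  refine congrArg (fun g : E3 → ℝ ↦ ∫ y, g y) (funext fun y ↦ ?_)
  refine setIntegral_congr_fun measurableSet_Ioc fun t' _ ↦ ?_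
  congr 1
  by_cases hy : R' ≤ ‖y‖
  · have hpos : 0 < E4.spatialNorm (E4.ofTimeSpace t' y) := by
      rw [E4.spatialNorm_ofTimeSpace]; exact hR'.trans_le hy
    rw [sum_fderiv_plateCurrent hpos ((hQ1.differentiable one_ne_zero) _),
      E4.spatialNorm_ofTimeSpace, E4.spatial_ofTimeSpace, hQval]
  · -- inside the collar ball: `Q` vanishes near the point, and so do both sides
    have hnot : E4.ofTimeSpace t' y ∉ tsupport Q := fun hmem ↦ by
      have := hQU hmem
      rw [Set.mem_setOf_eq, E4.spatialNorm_ofTimeSpace] at this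
      exact hy this
    have hQ0 : Q (E4.ofTimeSpace t' y) = 0 := image_eq_zero_of_notMem_tsupport hnot
    have hDQ0 : fderiv ℝ Q (E4.ofTimeSpace t' y) = 0 := fderiv_of_notMem_tsupport ℝ hnot
    have hJ0' : ∀ μ, fderiv ℝ (plateCurrent Q μ) (E4.ofTimeSpace t' y) = 0 := by
      intro μ
      refine fderiv_of_notMem_tsupport ℝ fun hmem ↦ hnot ?_
      refine Fin.cases (fun hmem ↦ ?_) (fun i hmem ↦ ?_) μ hmem
      · have : plateCurrent Q 0 = fun _ ↦ 0 := funext (plateCurrent_zero Q)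
        rw [this, tsupport] at hmem
        simp at hmem
      · have heq : plateCurrent Q i.succ = fun z ↦ Q z * (z i.succ / E4.spatialNorm z ^ 2) := by
          funext z; rw [plateCurrent_succ]; ring
        rw [heq] at hmem
        exact tsupport_mul_subset_left hmem
    simp only [hJ0', _root_.zero_apply, Finset.sum_const_zero]
    rw [hDQ0, _root_.zero_apply, zero_add, ← hQval, hQ0, zero_div]

end Kerr

end Literature.Geometry.Lorentzian
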